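import Literature.Topology.FourManifolds.LeeRasmussenProofs
import Literature.Topology.FourManifolds.KhComplexQDegreeProofs
import Literature.Topology.FourManifolds.KhFaces
import HarnessLib

/-!
# Rasmussen's `s` of the reversed Gauss diagram: `s(rK) = s(K)` at the level of diagrams

Sibling proof file of `LeeRasmussen.lean` (next to `LeeRasmussenProofs.lean`), proving that the
Rasmussen invariant of a Gauss diagram does not depend on the orientation of the base circle:

* `GaussDiagram.rasmussenInvariant_reverse` — **`s(G.reverse) = s(G)`** for *every* (possibly
  virtual) Gauss diagram `G`, where `GaussDiagram.reverse` (`GaussDiagrams.lean`) reverses the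
  order of the `2n` marked points (position `q ↦ 2n - 1 - q`), keeping chords and signs: the
  Gauss diagram of the same plane curve run backwards, i.e. of the reversed knot
  (`Knot.HasGaussDiagram.reverse`, discharged in `GaussDiagramsReverseProofs.lean`).

This is the diagrammatic content of Rasmussen (2010), §3.5 / the statement file's named fact
`HasRasmussenInvariant.reverse` (`Rasmussen.lean`): *Khovanov homology, Lee homology and the
filtration — hence `s` — do not depend on the orientation of a knot.* Indeed the cube of
resolutions of a knot diagram never uses the orientation except through the signs of the
crossings (which fix `n₊`, `n₋` and the oriented resolution), and the sign of a crossing of a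
knot is unchanged when the orientation is reversed (both strands reverse).

## Proof

Reversal is the identity on chords, states and Koszul signs, and acts on arcs by the bijection
`revArc` (arc `q`, from marked point `q` to `q + 1`, becomes arc `2n - 2 - q (mod 2n)`), which
exchanges the arc *entering* a marked point with the arc *leaving* the reversed point
(`revArc_arcIn`, `revArc_arcOut`). It carries the reconnection relation of every state onto that
of the reversed diagram (`stateAdj_reverse`: Seifert reconnections `arcIn p ~ arcOut p̄` go to
Seifert reconnections read from the partner end, the half-twisted ones `arcIn p ~ arcIn p̄`,
`arcOut p ~ arcOut p̄` are exchanged), hence state circles to state circles (`revCircleEquiv`) and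
enhanced states to enhanced states of the same bidegree (`revStates`, `homDegree_revStates`,
`qDegree_revStates`). At a chord `i` the two local strands `arcIn (overPos i)`, `arcOut (overPos i)`
used by `IsMergeAt` / `IsSplitAt` / `incidence` are *exchanged* by the reversal
(`reverse_arcIn_overPos`, `reverse_arcOut_overPos`) — so reversal is not a `Transfer` in the
sense of `LeeRasmussenProofs.lean` — but merges, splits and incidence numbers are symmetric in
the two local strands: the multiplication of the Frobenius algebra is commutative
(`KhFace.mergeCoeff_comm`), the comultiplication is cocommutative (`KhFace.splitCoeff_comm`,
both `KhFaces.lean`), and the two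
strands lie on one circle after a merge and before a split (`IsMergeAt.not_isSplitAt_holds`), so
the labels read there agree. Hence the incidence numbers of `G.reverse` between reversed
enhanced states are literally those of `G` (`incidence_revStates`, every `(R, h, t)`), and
`rasmussenInvariant_eq_of_transport` (`LeeRasmussenProofs.lean`, signs `ε = 1`) gives
`s(G.reverse) = s(G)`; likewise `leeSMax_reverse`.

## References

* J. Rasmussen, *Khovanov homology and the slice genus*, Invent. Math. 182 (2010) 419–447
  (arXiv:math/0402131), §2 (the cube of resolutions and Lee's complex of an oriented diagram use
  the orientation only through `n₊`, `n₋`), §3.5, Def. 3.4. [cite: Rasmussen2010, §3.5]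
* M. Khovanov, *A categorification of the Jones polynomial*, Duke Math. J. 101 (2000) 359–426,
  §4.2 (the cube complex), §7 (properties: independence of orientation for knots, Prop. 33 ff.).
  [cite: Khovanov2000, §4.2]
* O. Viro, *Khovanov homology, its definitions and ramifications*, Fund. Math. 184 (2004)
  317–342, §5 (enhanced states of a Gauss diagram; incidence numbers, §5.2). [cite: Viro2004, §5]
* M. Goussarov, M. Polyak, O. Viro, *Finite-type invariants of classical and virtual knots*,
  Topology 39 (2000), §1.4 (reversal of a Gauss diagram). [cite: GPV2000, §1.4]
* Tree: `LeeRasmussenProofs` (`rasmussenInvariant_eq_of_transport`, `leeSMax_eq_of_transport`,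
  `incidence_of_update`, `incidence_eq_zero_of_not_exists`, `EnhancedState.ext'`,
  `arcCount_eq_of_pos`), `KhComplexQDegreeProofs` (`EnhancedState.label_eq_of_circleOf_eq`),
  `KhFaces` (`KhFace.mergeCoeff_comm`, `KhFace.splitCoeff_comm`), `KhResolutions`
  (`IsMergeAt.not_isSplitAt_holds`).

## Design notes

No definitions of `Prop` type, no named facts, no `sorry`; the auxiliary definitions (`revArc`,
`revArcEquiv`, `revPos`, `revGraphIso`, `revCircleEquiv`, `EnhancedState.rev`, `EnhancedState.unrev`,
`revStates`) are concrete data with bodies. Everything is proved for abstract Gauss diagrams (no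
realisability hypothesis): reversal needs no planarity.
-/

open Function Set

noncomputable section

namespace Literature.Topology.FourManifolds

namespace GaussDiagram

variable (G : GaussDiagram)

/-! ## Reversal bookkeeping: chords, marked points, signs -/

/-- The reversal of the `2n` marked points, `q ↦ 2n - 1 - q` (`Fin.revPerm`), as a permutation
with a name of its own (so that its occurrences have one syntactic form whether read in `G` or in
`G.reverse`, whose position types agree definitionally). GPV (2000), §1.4. [cite: GPV2000, §1.4] -/
def revPos : _root_.Equiv.Perm (Fin (2 * G.n)) := Fin.revPerm

/-- The value of a reversed marked point: `2n - 1 - q`. [folklore] -/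
theorem val_revPos (p : Fin (2 * G.n)) : (G.revPos p : ℕ) = 2 * G.n - (p.val + 1) := Fin.val_rev p

/-- Reversal moves the over-passages by the reversal of positions. [folklore] -/
theorem reverse_overPos_eq (i : Fin G.n) : G.reverse.overPos i = G.revPos (G.overPos i) := rfl

/-- Reversal moves the under-passages by the reversal of positions. [folklore] -/
theorem reverse_underPos_eq (i : Fin G.n) : G.reverse.underPos i = G.revPos (G.underPos i) := rfl

/-- The chord through the reversed marked point is the chord through the point. [folklore] -/
@[simp] theorem chordOf_revPos (p : Fin (2 * G.n)) : G.reverse.chordOf (G.revPos p) = G.chordOf p := by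
  obtain ⟨i, rfl | rfl⟩ := G.exists_chord p
  · rw [chordOf_overPos, ← reverse_overPos_eq, chordOf_overPos]
  · rw [chordOf_underPos, ← reverse_underPos_eq, chordOf_underPos]

/-- Reversal commutes with taking the partner end of a chord. [folklore] -/
@[simp] theorem partner_revPos (p : Fin (2 * G.n)) :
    G.reverse.partner (G.revPos p) = G.revPos (G.partner p) := by
  obtain ⟨i, rfl | rfl⟩ := G.exists_chord p
  · rw [partner_overPos, ← reverse_overPos_eq, partner_overPos, reverse_underPos_eq]
  · rw [partner_underPos, ← reverse_underPos_eq, partner_underPos, reverse_overPos_eq]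

/-- Reversal keeps the Seifert rule (same chords, same signs, same states). [folklore] -/
@[simp] theorem isSeifert_reverse (σ : G.State) (i : Fin G.n) :
    G.reverse.isSeifert σ i = G.isSeifert σ i := rfl

/-- Reversal keeps the number of positive crossings. [folklore] -/
@[simp] theorem nPlus_reverse : G.reverse.nPlus = G.nPlus := rfl

/-- Reversal keeps the number of negative crossings. [folklore] -/
@[simp] theorem nMinus_reverse : G.reverse.nMinus = G.nMinus := rfl

/-- Reversal keeps the number of arcs. [folklore] -/
theorem arcCount_reverse : G.reverse.arcCount = G.arcCount := rfl

/-! ## The reversal of arcs -/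

/-- **The reversal of arcs.** Arc `q` of `G` (from marked point `q` to marked point `q + 1`) is,
run backwards, the arc of `G.reverse` from `rev (q + 1) = 2n - 2 - q` to `rev q`, i.e. arc number
`2n - 2 - q (mod 2n)`: the last arc (through the base point) is fixed and the others are reversed
in order. For the empty diagram the single arc is fixed. GPV (2000), §1.4. [cite: GPV2000, §1.4] -/
def revArc (a : G.Arc) : G.Arc :=
  ⟨if a.val + 2 ≤ G.arcCount then G.arcCount - 2 - a.val else a.val, by
    have := a.isLt; split_ifs <;> omega⟩

/-- The value of the reversed arc. [folklore] -/
theorem val_revArc (a : G.Arc) :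
    (G.revArc a : ℕ) = if a.val + 2 ≤ G.arcCount then G.arcCount - 2 - a.val else a.val := rfl

/-- The reversal of arcs is an involution. [folklore] -/
@[simp] theorem revArc_revArc (a : G.Arc) : G.revArc (G.revArc a) = a := by
  apply Fin.ext
  have := a.isLt
  simp only [val_revArc]
  split_ifs <;> omega

/-- The reversal of arcs as a bijection from the arcs of `G` to the arcs of `G.reverse` (the same
type, definitionally); an involution. [folklore] -/
def revArcEquiv : G.Arc ≃ G.reverse.Arc :=
  Function.Involutive.toPerm G.revArc G.revArc_revArc

/-- The bijection of arcs is `revArc`. [folklore] -/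
@[simp] theorem revArcEquiv_apply (a : G.Arc) : G.revArcEquiv a = G.revArc a := rfl

/-- The inverse bijection of arcs is `revArc` again. [folklore] -/
@[simp] theorem revArcEquiv_symm_apply (a : G.reverse.Arc) : G.revArcEquiv.symm a = G.revArc a := by
  rw [_root_.Equiv.symm_apply_eq, revArcEquiv_apply, revArc_revArc]

/-- The value of the arc entering a marked point: `p - 1`, cyclically. [folklore] -/
theorem val_arcIn (p : Fin (2 * G.n)) :
    (G.arcIn p : ℕ) = if p.val = 0 then 2 * G.n - 1 else p.val - 1 := by
  have hp := p.isLt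
  show (p.val + 2 * G.n - 1) % (2 * G.n) = _
  split_ifs with h0
  · rw [h0, Nat.zero_add, Nat.mod_eq_of_lt (by omega)]
  · rw [show p.val + 2 * G.n - 1 = (p.val - 1) + 2 * G.n by omega, Nat.add_mod_right,
      Nat.mod_eq_of_lt (by omega)]

/-- **Reversal exchanges entering and leaving arcs, I**: the reversed arc of the arc leaving `p`
is the arc entering the reversed point. [folklore] -/
theorem revArc_arcOut (p : Fin (2 * G.n)) : G.revArc (G.arcOut p) = G.reverse.arcIn (G.revPos p) := by
  apply Fin.ext
  rw [G.reverse.val_arcIn (G.revPos p), val_revPos]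
  show (if p.val + 2 ≤ max (2 * G.n) 1 then max (2 * G.n) 1 - 2 - p.val else p.val) =
    if 2 * G.n - (p.val + 1) = 0 then 2 * G.n - 1 else 2 * G.n - (p.val + 1) - 1
  have hp := p.isLt
  split_ifs <;> omega

/-- **Reversal exchanges entering and leaving arcs, II**: the reversed arc of the arc entering
`p` is the arc leaving the reversed point. [folklore] -/
theorem revArc_arcIn (p : Fin (2 * G.n)) : G.revArc (G.arcIn p) = G.reverse.arcOut (G.revPos p) := by
  apply Fin.ext
  show (G.revArc (G.arcIn p)).val = (G.revPos p).val
  rw [val_revArc, G.val_arcIn p, val_revPos]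
  show (if (if p.val = 0 then 2 * G.n - 1 else p.val - 1) + 2 ≤ max (2 * G.n) 1 then
      max (2 * G.n) 1 - 2 - (if p.val = 0 then 2 * G.n - 1 else p.val - 1)
    else if p.val = 0 then 2 * G.n - 1 else p.val - 1) = 2 * G.n - (p.val + 1)
  have hp := p.isLt
  split_ifs <;> omega

/-- At every chord, the arc *entering* the over-passage of the reversed diagram is the reversed
arc of the arc *leaving* the over-passage: reversal exchanges the two local strands used by
`IsMergeAt`, `IsSplitAt` and `incidence`. [folklore] -/
theorem reverse_arcIn_overPos (i : Fin G.n) :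
    G.reverse.arcIn (G.reverse.overPos i) = G.revArc (G.arcOut (G.overPos i)) :=
  (G.revArc_arcOut (G.overPos i)).symm

/-- At every chord, the arc *leaving* the over-passage of the reversed diagram is the reversed
arc of the arc *entering* the over-passage. [folklore] -/
theorem reverse_arcOut_overPos (i : Fin G.n) :
    G.reverse.arcOut (G.reverse.overPos i) = G.revArc (G.arcIn (G.overPos i)) :=
  (G.revArc_arcIn (G.overPos i)).symm

/-- The reversal of arcs is injective, as a map to the arcs of the reversed diagram (whose type of
arcs is definitionally that of `G`). [folklore] -/
theorem revArc_apply_eq_iff (a b : G.Arc) : @Eq G.reverse.Arc (G.revArc a) (G.revArc b) ↔ a = b :=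
  G.revArcEquiv.injective.eq_iff

/-- A reversed arc is the arc entering the reversed point `q` iff the arc is the arc leaving `q`.
[folklore] -/
theorem revArc_eq_arcIn_iff (a : G.Arc) (q : Fin (2 * G.n)) :
    @Eq G.reverse.Arc (G.revArc a) (G.reverse.arcIn (G.revPos q)) ↔ a = G.arcOut q := by
  rw [← revArc_arcOut]
  exact G.revArc_apply_eq_iff a _

/-- A reversed arc is the arc leaving the reversed point `q` iff the arc is the arc entering `q`.
[folklore] -/
theorem revArc_eq_arcOut_iff (a : G.Arc) (q : Fin (2 * G.n)) :
    @Eq G.reverse.Arc (G.revArc a) (G.reverse.arcOut (G.revPos q)) ↔ a = G.arcIn q := by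
  rw [← revArc_arcIn]
  exact G.revArc_apply_eq_iff a _

/-! ## Reversal carries the reconnection relation and the state circles -/

/-- **Reversal carries the reconnection relation of every state to that of the reversed
diagram.** A Seifert reconnection `arcIn p ~ arcOut p̄` of `G` becomes, read backwards, the
Seifert reconnection `arcIn (rev p̄) ~ arcOut (rev p)` of `G.reverse` at the partner end; a
half-twisted reconnection `arcIn p ~ arcIn p̄` becomes `arcOut (rev p) ~ arcOut (rev p̄)` and
conversely. Viro (2004), §2, §5 (the resolved 1-manifold of a state is the surgery of the circle
along the chords, independent of the orientation of the circle). [cite: Viro2004, §2] -/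
theorem stateAdj_reverse (σ : G.State) (a b : G.Arc) :
    G.reverse.stateAdj σ (G.revArc a) (G.revArc b) ↔ G.stateAdj σ a b := by
  unfold stateAdj
  refine and_congr (G.revArc_apply_eq_iff a b).not ⟨?_, ?_⟩
  · rintro ⟨p', hp'⟩
    obtain ⟨q, rfl⟩ := G.revPos.surjective p'
    simp only [chordOf_revPos, partner_revPos, isSeifert_reverse, revArc_eq_arcIn_iff,
      revArc_eq_arcOut_iff] at hp'
    rcases hp' with ⟨hS, ⟨rfl, rfl⟩ | ⟨rfl, rfl⟩⟩ | ⟨hS, ⟨rfl, rfl⟩ | ⟨rfl, rfl⟩⟩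
    · exact ⟨G.partner q, Or.inl ⟨by rwa [chordOf_partner], Or.inr ⟨rfl, by rw [partner_partner]⟩⟩⟩
    · exact ⟨G.partner q, Or.inl ⟨by rwa [chordOf_partner], Or.inl ⟨rfl, by rw [partner_partner]⟩⟩⟩
    · exact ⟨q, Or.inr ⟨hS, Or.inr ⟨rfl, rfl⟩⟩⟩
    · exact ⟨q, Or.inr ⟨hS, Or.inl ⟨rfl, rfl⟩⟩⟩
  · rintro ⟨p, hp⟩
    rcases hp with ⟨hS, ⟨rfl, rfl⟩ | ⟨rfl, rfl⟩⟩ | ⟨hS, ⟨rfl, rfl⟩ | ⟨rfl, rfl⟩⟩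
    · -- `arcIn p ~ arcOut p̄` (Seifert) becomes, read from the partner end, a Seifert
      -- reconnection of the reversed diagram at `rev p̄`
      refine ⟨G.revPos (G.partner p), Or.inl ⟨?_, Or.inr ⟨G.revArc_arcOut _, ?_⟩⟩⟩
      · rw [chordOf_revPos, chordOf_partner]; exact hS
      · rw [partner_revPos, partner_partner]; exact G.revArc_arcIn p
    · refine ⟨G.revPos (G.partner p), Or.inl ⟨?_, Or.inl ⟨G.revArc_arcOut _, ?_⟩⟩⟩
      · rw [chordOf_revPos, chordOf_partner]; exact hS
      · rw [partner_revPos, partner_partner]; exact G.revArc_arcIn p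
    · -- the half-twisted reconnections `arcIn p ~ arcIn p̄` and `arcOut ~ arcOut` are exchanged
      refine ⟨G.revPos p, Or.inr ⟨?_, Or.inr ⟨G.revArc_arcIn p, ?_⟩⟩⟩
      · rw [chordOf_revPos]; exact hS
      · rw [partner_revPos]; exact G.revArc_arcIn _
    · refine ⟨G.revPos p, Or.inr ⟨?_, Or.inl ⟨G.revArc_arcOut p, ?_⟩⟩⟩
      · rw [chordOf_revPos]; exact hS
      · rw [partner_revPos]; exact G.revArc_arcOut _

/-- The reversal of arcs is an isomorphism from the state graph of `σ` in `G` to the state graph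
of `σ` in `G.reverse`. [folklore] -/
def revGraphIso (σ : G.State) : G.stateGraph σ ≃g G.reverse.stateGraph σ where
  toEquiv := G.revArcEquiv
  map_rel_iff' := by
    intro a b
    show (G.reverse.stateGraph σ).Adj (G.revArc a) (G.revArc b) ↔ (G.stateGraph σ).Adj a b
    simp only [stateGraph, SimpleGraph.fromRel_adj, ne_eq]
    rw [G.revArc_apply_eq_iff a b, G.stateAdj_reverse σ a b, G.stateAdj_reverse σ b a]

/-- The isomorphism of state graphs is the reversal of arcs. [folklore] -/
@[simp] theorem revGraphIso_apply (σ : G.State) (a : G.Arc) : G.revGraphIso σ a = G.revArc a := rfl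

/-- The induced bijection of state circles under reversal. [folklore] -/
def revCircleEquiv (σ : G.State) : G.StateCircle σ ≃ G.reverse.StateCircle σ :=
  (G.revGraphIso σ).connectedComponentEquiv

/-- The bijection of state circles sends the circle of an arc to the circle of the reversed arc.
[folklore] -/
@[simp] theorem revCircleEquiv_circleOf (σ : G.State) (a : G.Arc) :
    G.revCircleEquiv σ (G.circleOf σ a) = G.reverse.circleOf σ (G.revArc a) := rfl

/-- Two arcs lie on the same state circle iff their reversed arcs do. [folklore] -/
theorem circleOf_revArc_eq_iff (σ : G.State) (a b : G.Arc) :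
    G.reverse.circleOf σ (G.revArc a) = G.reverse.circleOf σ (G.revArc b) ↔
      G.circleOf σ a = G.circleOf σ b := by
  rw [← revCircleEquiv_circleOf, ← revCircleEquiv_circleOf, (G.revCircleEquiv σ).injective.eq_iff]

/-! ## Reversal of enhanced states -/

variable {G}

/-- The **reversed enhanced state**: the same state, labels carried along the reversal of arcs.
Viro (2004), §5.1. [cite: Viro2004, §5.1] -/
def EnhancedState.rev (s : G.EnhancedState) : G.reverse.EnhancedState where
  state := s.state
  label := s.label ∘ G.revArcEquiv.symm
  label_eq _ _ hab := s.label_eq _ _ ((G.revGraphIso s.state).symm.map_rel_iff.2 hab)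

/-- The inverse of the reversal of enhanced states. [folklore] -/
def EnhancedState.unrev (u : G.reverse.EnhancedState) : G.EnhancedState where
  state := u.state
  label := u.label ∘ G.revArcEquiv
  label_eq _ _ hab := u.label_eq _ _ ((G.revGraphIso u.state).map_rel_iff.2 hab)

/-- The state of the reversed enhanced state. [folklore] -/
@[simp] theorem EnhancedState.rev_state (s : G.EnhancedState) : s.rev.state = s.state := rfl

/-- The labels of the reversed enhanced state. [folklore] -/
@[simp] theorem EnhancedState.rev_label (s : G.EnhancedState) :
    s.rev.label = s.label ∘ G.revArcEquiv.symm := rfl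

/-- The state of the back-reversed enhanced state. [folklore] -/
@[simp] theorem EnhancedState.unrev_state (u : G.reverse.EnhancedState) : u.unrev.state = u.state :=
  rfl

/-- The labels of the back-reversed enhanced state. [folklore] -/
@[simp] theorem EnhancedState.unrev_label (u : G.reverse.EnhancedState) :
    u.unrev.label = u.label ∘ G.revArcEquiv := rfl

variable (G) in
/-- **Reversal is a bijection of enhanced states.** Khovanov (2000), §4.2; Viro (2004), §5.1.
[cite: Viro2004, §5.1] -/
def revStates : G.EnhancedState ≃ G.reverse.EnhancedState where
  toFun := EnhancedState.rev
  invFun := EnhancedState.unrev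
  left_inv s := EnhancedState.ext' rfl (by ext a; simp)
  right_inv u := EnhancedState.ext' rfl (by ext a; simp)

/-- The bijection of enhanced states is `EnhancedState.rev`. [folklore] -/
@[simp] theorem revStates_apply (s : G.EnhancedState) : G.revStates s = s.rev := rfl

/-- Reversal preserves the homological degree (same state, same `n₋`). Bar-Natan (2002), §3.2.
[cite: BarNatan2002, §3.2] -/
theorem homDegree_revStates (s : G.EnhancedState) : homDegree (G.revStates s) = homDegree s := rfl

/-- The bijection of state circles matches the circles carrying a given label. [folklore] -/
theorem card_filter_label_rev (s : G.EnhancedState) (b : Bool) :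
    (Finset.univ.filter fun c' : G.reverse.StateCircle s.rev.state ↦
        ∃ a', G.reverse.circleOf s.rev.state a' = c' ∧ s.rev.label a' = b).card =
      (Finset.univ.filter fun c : G.StateCircle s.state ↦
        ∃ a, G.circleOf s.state a = c ∧ s.label a = b).card := by
  symm
  refine Finset.card_equiv (G.revCircleEquiv s.state) fun c ↦ ?_
  simp only [Finset.mem_filter, Finset.mem_univ, true_and]
  constructor
  · rintro ⟨a, rfl, hb⟩
    exact ⟨G.revArc a, rfl, by simpa using hb⟩
  · rintro ⟨a', ha', hb⟩
    refine ⟨G.revArc a', (G.revCircleEquiv s.state).injective ?_, by simpa using hb⟩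
    rw [revCircleEquiv_circleOf, revArc_revArc]
    exact ha'

/-- Reversal preserves the quantum degree. Bar-Natan (2002), §3.2. [cite: BarNatan2002, §3.2] -/
theorem qDegree_revStates (s : G.EnhancedState) : qDegree (G.revStates s) = qDegree s := by
  rw [revStates_apply]
  unfold qDegree
  rw [card_filter_label_rev s false, card_filter_label_rev s true]
  rfl

/-! ## Merges, splits and incidence numbers are symmetric in the two local strands -/

/-- Merges of the reversed diagram are the merges of the diagram (the two local strands at the
chord are exchanged, and being on different circles is symmetric). Viro (2004), §5.2.
[cite: Viro2004, §5.2] -/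
theorem isMergeAt_reverse (σ : G.State) (i : Fin G.n) : G.reverse.IsMergeAt σ i ↔ G.IsMergeAt σ i := by
  unfold IsMergeAt
  rw [reverse_arcIn_overPos, reverse_arcOut_overPos]
  exact and_congr Iff.rfl ((G.circleOf_revArc_eq_iff σ _ _).not.trans ne_comm)

/-- Splits of the reversed diagram are the splits of the diagram. Viro (2004), §5.2.
[cite: Viro2004, §5.2] -/
theorem isSplitAt_reverse (σ : G.State) (i : Fin G.n) : G.reverse.IsSplitAt σ i ↔ G.IsSplitAt σ i := by
  unfold IsSplitAt
  rw [reverse_arcIn_overPos, reverse_arcOut_overPos]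
  exact and_congr Iff.rfl ((G.circleOf_revArc_eq_iff _ _ _).not.trans ne_comm)

/-- After a merge at chord `i` the two local strands lie on one state circle (a merge is not a
split, `IsMergeAt.not_isSplitAt_holds`). Viro (2004), §5. [cite: Viro2004, §5] -/
theorem circleOf_update_eq_of_isMergeAt {σ : G.State} {i : Fin G.n} (h : G.IsMergeAt σ i) :
    G.circleOf (Function.update σ i true) (G.arcIn (G.overPos i)) =
      G.circleOf (Function.update σ i true) (G.arcOut (G.overPos i)) := by
  by_contra hne
  exact IsMergeAt.not_isSplitAt_holds h ⟨h.1, hne⟩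

/-- Before a split at chord `i` (which is not a merge) the two local strands lie on one state
circle. Viro (2004), §5. [cite: Viro2004, §5] -/
theorem circleOf_eq_of_not_isMergeAt {σ : G.State} {i : Fin G.n} (hi : σ i = false)
    (h : ¬ G.IsMergeAt σ i) :
    G.circleOf σ (G.arcIn (G.overPos i)) = G.circleOf σ (G.arcOut (G.overPos i)) := by
  by_contra hne
  exact h ⟨hi, hne⟩

/-- **Incidence numbers are invariant under reversal**: for every Frobenius system
`R[X]/(X² - hX - t)` and all enhanced states `s`, `s'` of `G`,
`⟨d s.rev, s'.rev⟩ = ⟨d s, s'⟩`. The flipped chord and the Koszul sign are the same; the two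
local strands are exchanged, which does not matter since the multiplication is commutative, the
comultiplication cocommutative, and the two strands carry the same label after a merge and
before a split. Viro (2004), §5.2; Khovanov (2000), §4.2. [cite: Viro2004, §5.2] -/
theorem incidence_revStates {R : Type} [CommRing R] (h t : R) (s s' : G.EnhancedState) :
    G.reverse.incidence R h t (G.revStates s) (G.revStates s') = G.incidence R h t s s' := by
  by_cases hex : ∃ i, s.state i = false ∧ s'.state = Function.update s.state i true
  swap
  · rw [incidence_eq_zero_of_not_exists (s := G.revStates s) (s' := G.revStates s') h t hex,
      incidence_eq_zero_of_not_exists h t hex]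
  obtain ⟨i, hi, hs'⟩ := hex
  rw [revStates_apply, revStates_apply, incidence_of_update h t (s := s.rev) (s' := s'.rev) hi hs',
    incidence_of_update h t hi hs']
  have hM := isMergeAt_reverse s.state i
  have hS := isSplitAt_reverse s.state i
  simp only [EnhancedState.rev_state] at hM hS ⊢
  -- the two local strands and their labels, exchanged by the reversal
  set a := G.arcIn (G.overPos i) with ha
  set b := G.arcOut (G.overPos i) with hb
  have hlab : ∀ (u : G.EnhancedState) (x : G.Arc), u.rev.label (G.revArc x) = u.label x := fun u x ↦ by
    simp
  rw [reverse_arcIn_overPos, reverse_arcOut_overPos, ← ha, ← hb, hlab, hlab, hlab, hlab]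
  -- the label conditions, transported along the reversal of arcs
  have hcond : ∀ (σ : G.State) (x : G.Arc),
      (∀ c', G.reverse.circleOf σ c' ≠ G.reverse.circleOf σ (G.revArc x) →
        s'.rev.label c' = s.rev.label c') ↔
      (∀ c, G.circleOf σ c ≠ G.circleOf σ x → s'.label c = s.label c) := fun σ x ↦ by
    constructor
    · intro H c hc
      simpa using H (G.revArc c) ((G.circleOf_revArc_eq_iff σ c x).not.2 hc)
    · intro H c' hc'
      obtain ⟨c, rfl⟩ := G.revArcEquiv.surjective c'
      rw [revArcEquiv_apply] at hc' ⊢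
      simpa using H c ((G.circleOf_revArc_eq_iff σ c x).not.1 hc')
  by_cases h1 : G.IsMergeAt s.state i
  · -- merge: after the flip the two strands lie on one circle, so their labels in `s'` agree
    have hab' : G.circleOf s'.state a = G.circleOf s'.state b := by
      rw [hs']; exact circleOf_update_eq_of_isMergeAt h1
    have hiff : (∀ c, G.circleOf s'.state c ≠ G.circleOf s'.state b → s'.label c = s.label c) ↔
        (∀ c, G.circleOf s'.state c ≠ G.circleOf s'.state a → s'.label c = s.label c) := by rw [hab']
    rw [if_pos h1, if_pos (hM.2 h1)]
    by_cases h2 : ∀ c, G.circleOf s'.state c ≠ G.circleOf s'.state a → s'.label c = s.label c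
    · rw [if_pos h2, if_pos ((hcond s'.state b).2 (hiff.2 h2)), s'.label_eq_of_circleOf_eq hab',
        KhFace.mergeCoeff_comm]
      rfl
    · rw [if_neg h2, if_neg (mt (fun H ↦ hiff.1 ((hcond s'.state b).1 H)) h2)]
  · rw [if_neg h1, if_neg (mt hM.1 h1)]
    by_cases h3 : G.IsSplitAt s.state i
    · -- split: before the flip the two strands lie on one circle, so their labels in `s` agree
      have hab : G.circleOf s.state a = G.circleOf s.state b := circleOf_eq_of_not_isMergeAt hi h1
      have hiff : (∀ c, G.circleOf s.state c ≠ G.circleOf s.state b → s'.label c = s.label c) ↔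
          (∀ c, G.circleOf s.state c ≠ G.circleOf s.state a → s'.label c = s.label c) := by rw [hab]
      rw [if_pos h3, if_pos (hS.2 h3)]
      by_cases h4 : ∀ c, G.circleOf s.state c ≠ G.circleOf s.state a → s'.label c = s.label c
      · rw [if_pos h4, if_pos ((hcond s.state b).2 (hiff.2 h4)), s.label_eq_of_circleOf_eq hab,
          KhFace.splitCoeff_comm]
        rfl
      · rw [if_neg h4, if_neg (mt (fun H ↦ hiff.1 ((hcond s.state b).1 H)) h4)]
    · rw [if_neg h3, if_neg (mt hS.1 h3)]

/-! ## `s_max` and `s` of the reversed diagram -/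

variable (G)

/-- **`s_max` of a Gauss diagram does not depend on the orientation of the base circle**:
`s_max(G.reverse) = s_max(G)`. The reversal of enhanced states is an isomorphism of the cubes of
resolutions preserving both gradings (`incidence_revStates`, `homDegree_revStates`,
`qDegree_revStates`), hence a filtered isomorphism of Lee complexes (`leeSMax_eq_of_transport`,
signs `ε = 1`). Rasmussen (2010), §3.5, Def. 3.1. [cite: Rasmussen2010, §3.5] -/
theorem leeSMax_reverse : G.reverse.leeSMax = G.leeSMax :=
  leeSMax_eq_of_transport G.revStates homDegree_revStates (fun _ ↦ 1) qDegree_revStates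
    (fun _ ↦ by norm_num) fun s s' ↦ by rw [incidence_revStates]; ring

/-- **Rasmussen's `s` of a Gauss diagram does not depend on the orientation of the base
circle**: `s(G.reverse) = s(G)` for every Gauss diagram `G`, where `G.reverse` is the diagram of
the same plane curve run backwards (the reversed knot, `Knot.HasGaussDiagram.reverse`). This is
the diagrammatic content of `s(rK) = s(K)`: Lee's complex with its filtration uses the
orientation of a knot diagram only through the signs of the crossings, which reversal keeps.
Rasmussen (2010), §3.5, Def. 3.4; Khovanov (2000), §4.2. [cite: Rasmussen2010, §3.5] -/
theorem rasmussenInvariant_reverse : G.reverse.rasmussenInvariant = G.rasmussenInvariant :=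
  rasmussenInvariant_eq_of_transport G.revStates homDegree_revStates (fun _ ↦ 1) qDegree_revStates
    (fun _ ↦ by norm_num) fun s s' ↦ by rw [incidence_revStates]; ring

end GaussDiagram

end Literature.Topology.FourManifolds
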